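import Summits.Ventures.HodgeRepro2.T5SU11SphericalUnique
import Summits.Ventures.HodgeRepro2.T5SU11SphericalLegendre

/-!
# Consequences of uniqueness: the functional equation, `φ_0 = φ_2 = 1` and `φ_4 = cosh 2t` re-derived
from the radial equation, and the NEW closed forms `φ_6(a_t) = P_2(cosh 2t)`, `φ_8(a_t) = P_3(cosh 2t)`

With `x = cosh 2t` the radial equation `(sinh 2t u')' = λ(λ − 2) sinh 2t u` is Legendre's equation
`(1 − x²) y'' − 2x y' + n(n+1) y = 0` for `λ = 2n + 2`, so the spherical functions of parameter `2n + 2`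
are the Legendre polynomials in `cosh 2t`. By the uniqueness theorem of `T5SU11SphericalUnique`
(the normalised `C²` solution is `φ_λ(a_·)`) it suffices to VERIFY the equation and the value `1` at
`0` for each candidate: **`φ_6(a_t) = (3 cosh² 2t − 1)/2`** and **`φ_8(a_t) = (5 cosh³ 2t − 3 cosh 2t)/2`**
(`sph_six_hyp`, `sph_eight_hyp`), i.e. on the group `φ_6 = P_2(φ_4)`, `φ_8 = P_3(φ_4)` with
`φ_4(g) = 2|a(g)|² − 1` (`sph_six_eq`, `sph_eight_eq`); and the earlier closed forms are re-derived from
the equation alone — `φ_4(a_t) = cosh 2t` (`sph_four_hyp_of_ode`, first proved by Laplace's integral in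
`T5SU11SphericalLegendre`), `φ_2 ≡ 1` and `φ_0 ≡ 1` (the constant solves the equation when
`λ(λ − 2) = 0`, `sph_two_hyp_of_ode`, `sph_zero_hyp_of_ode`), and the functional equation
`φ_{2−λ} = φ_λ` (`sph_two_sub_of_ode`: both sides solve the same equation, `(2−λ)(−λ) = λ(λ−2)`, first
proved by a change of variables on the circle in `T5SU11SphericalSymmetry`). Nothing is claimed
about (N).

Blind lane: Mathlib + the HodgeRepro2 prefix only; no sorry; axioms ⊆ {propext, Classical.choice,
Quot.sound}.
-/

namespace Summit.Ventures.HodgeRepro2.T5SU11SphericalLegendreHigher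

open MeasureTheory Metric Set Filter Topology
open T5SU11Unimodular T5SU11Cartan T5SU11CartanProjection T5BergmanCoefficient
  T5SU11SphericalFunction T5SU11SphericalODE T5SU11SphericalLegendre T5SU11SphericalUnique
open scoped Real

/-! ### Derivatives of `cosh 2t` and `sinh 2t` -/

/-- `(cosh 2t)' = 2 sinh 2t`. -/
lemma hasDerivAt_cosh_two_mul_self (t : ℝ) :
    HasDerivAt (fun t => Real.cosh (2 * t)) (2 * Real.sinh (2 * t)) t := by
  have := (Real.hasDerivAt_cosh (2 * t)).comp t ((hasDerivAt_id t).const_mul 2)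
  refine this.congr_deriv ?_
  simp only [mul_one]
  ring

/-- `(sinh 2t)' = 2 cosh 2t`. -/
lemma hasDerivAt_sinh_two_mul_self (t : ℝ) :
    HasDerivAt (fun t => Real.sinh (2 * t)) (2 * Real.cosh (2 * t)) t := by
  have := (Real.hasDerivAt_sinh (2 * t)).comp t ((hasDerivAt_id t).const_mul 2)
  refine this.congr_deriv ?_
  simp only [mul_one]
  ring

section measure

variable [MeasurableSpace Circle] [BorelSpace Circle]

/-! ### The constant solution and the functional equation -/

/-- **`φ_2 ≡ 1` from the radial equation** (the constant `1` solves it for `λ = 2`). -/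
theorem sph_two_hyp_of_ode (t : ℝ) : sph 2 (hyp t) = 1 := by
  symm
  refine eq_sph_hyp_of_ode 2 (v := fun _ => 1) (v' := fun _ => 0) (v'' := fun _ => 0)
    (fun t => hasDerivAt_const t 1) (fun t => hasDerivAt_const t 0) (fun t => ?_) rfl t
  ring

/-- **`φ_0 ≡ 1` from the radial equation.** -/
theorem sph_zero_hyp_of_ode (t : ℝ) : sph 0 (hyp t) = 1 := by
  symm
  refine eq_sph_hyp_of_ode 0 (v := fun _ => 1) (v' := fun _ => 0) (v'' := fun _ => 0)
    (fun t => hasDerivAt_const t 1) (fun t => hasDerivAt_const t 0) (fun t => ?_) rfl t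
  ring

/-- **The functional equation from uniqueness**: `φ_{2−λ}(a_t) = φ_λ(a_t)` — both solve the radial
equation with `(2 − λ)(−λ) = λ(λ − 2)` and are `1` at `0`. -/
theorem sph_two_sub_of_ode (lam t : ℝ) : sph (2 - lam) (hyp t) = sph lam (hyp t) := by
  obtain ⟨φ', φ'', hφ, hφ', hode⟩ := exists_hasDerivAt_sph_hyp_ode (2 - lam)
  refine eq_sph_hyp_of_ode lam hφ hφ' (fun s => ?_) ?_ t
  · rw [hode s]
    ring
  · rw [T5SU11OneParameter.hyp_zero, sph_one]

/-! ### `φ_4 = cosh 2t` from the radial equation -/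

/-- **`φ_4(a_t) = cosh 2t` from the radial equation** (re-deriving `T5SU11SphericalLegendre.sph_four_hyp`,
which was obtained from Laplace's integral). -/
theorem sph_four_hyp_of_ode (t : ℝ) : sph 4 (hyp t) = Real.cosh (2 * t) := by
  symm
  refine eq_sph_hyp_of_ode 4 (v := fun t => Real.cosh (2 * t)) (v' := fun t => 2 * Real.sinh (2 * t))
    (v'' := fun t => 4 * Real.cosh (2 * t)) hasDerivAt_cosh_two_mul_self (fun t => ?_) (fun t => ?_) ?_ t
  · refine ((hasDerivAt_sinh_two_mul_self t).const_mul 2).congr_deriv ?_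
    ring
  · ring
  · simp

/-! ### New closed forms: `φ_6` and `φ_8` -/

/-- **`φ_6(a_t) = (3 cosh² 2t − 1)/2 = P_2(cosh 2t)`.** -/
theorem sph_six_hyp (t : ℝ) : sph 6 (hyp t) = (3 * Real.cosh (2 * t) ^ 2 - 1) / 2 := by
  symm
  refine eq_sph_hyp_of_ode 6 (v := fun t => (3 * Real.cosh (2 * t) ^ 2 - 1) / 2)
    (v' := fun t => 6 * Real.cosh (2 * t) * Real.sinh (2 * t))
    (v'' := fun t => 12 * Real.sinh (2 * t) ^ 2 + 12 * Real.cosh (2 * t) ^ 2)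
    (fun t => ?_) (fun t => ?_) (fun t => ?_) ?_ t
  · have h := (((hasDerivAt_cosh_two_mul_self t).pow 2).const_mul 3).sub_const 1 |>.div_const 2
    refine h.congr_deriv ?_
    simp only [Nat.cast_ofNat]
    ring
  · have h := ((hasDerivAt_cosh_two_mul_self t).const_mul 6).mul (hasDerivAt_sinh_two_mul_self t)
    refine h.congr_deriv ?_
    ring
  · have := Real.cosh_sq (2 * t)
    linear_combination (-12 * Real.sinh (2 * t)) * this
  · norm_num

/-- **`φ_8(a_t) = (5 cosh³ 2t − 3 cosh 2t)/2 = P_3(cosh 2t)`.** -/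
theorem sph_eight_hyp (t : ℝ) :
    sph 8 (hyp t) = (5 * Real.cosh (2 * t) ^ 3 - 3 * Real.cosh (2 * t)) / 2 := by
  symm
  refine eq_sph_hyp_of_ode 8 (v := fun t => (5 * Real.cosh (2 * t) ^ 3 - 3 * Real.cosh (2 * t)) / 2)
    (v' := fun t => (15 * Real.cosh (2 * t) ^ 2 - 3) * Real.sinh (2 * t))
    (v'' := fun t => 60 * Real.cosh (2 * t) * Real.sinh (2 * t) ^ 2
      + (30 * Real.cosh (2 * t) ^ 2 - 6) * Real.cosh (2 * t))
    (fun t => ?_) (fun t => ?_) (fun t => ?_) ?_ t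
  · have h := ((((hasDerivAt_cosh_two_mul_self t).pow 3).const_mul 5).sub
      ((hasDerivAt_cosh_two_mul_self t).const_mul 3)).div_const 2
    refine h.congr_deriv ?_
    simp only [Nat.cast_ofNat]
    ring
  · have h := ((((hasDerivAt_cosh_two_mul_self t).pow 2).const_mul 15).sub_const 3).mul
      (hasDerivAt_sinh_two_mul_self t)
    refine h.congr_deriv ?_
    simp only [Nat.cast_ofNat, Pi.pow_apply]
    ring
  · have := Real.cosh_sq (2 * t)
    linear_combination (-60 * Real.cosh (2 * t) * Real.sinh (2 * t)) * this
  · norm_num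

/-- **On the group**: `φ_6 = P_2(φ_4)`, i.e. `φ_6(g) = (3 φ_4(g)² − 1)/2` with `φ_4(g) = 2|a(g)|² − 1`. -/
theorem sph_six_eq (g : SU11) : sph 6 g = (3 * sph 4 g ^ 2 - 1) / 2 := by
  rw [sph_eq_sph_hyp_cartanT 6 g, sph_eq_sph_hyp_cartanT 4 g, sph_six_hyp, sph_four_hyp]

/-- **On the group**: `φ_8 = P_3(φ_4)`, i.e. `φ_8(g) = (5 φ_4(g)³ − 3 φ_4(g))/2`. -/
theorem sph_eight_eq (g : SU11) : sph 8 g = (5 * sph 4 g ^ 3 - 3 * sph 4 g) / 2 := by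
  rw [sph_eq_sph_hyp_cartanT 8 g, sph_eq_sph_hyp_cartanT 4 g, sph_eight_hyp, sph_four_hyp]

/-- `φ_6(g) = (3 (2|a(g)|² − 1)² − 1)/2`. -/
theorem sph_six_eq_norm_mat (g : SU11) :
    sph 6 g = (3 * (2 * ‖mat g 0 0‖ ^ 2 - 1) ^ 2 - 1) / 2 := by
  rw [sph_six_eq, sph_four]

/-- The values at `−4` and `−6` (the functional equation): `φ_{−4} = φ_6`, `φ_{−6} = φ_8`. -/
theorem sph_neg_four_hyp (t : ℝ) : sph (-4) (hyp t) = (3 * Real.cosh (2 * t) ^ 2 - 1) / 2 := by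
  rw [← sph_six_hyp, ← sph_two_sub_of_ode 6 t]
  norm_num

/-- `φ_{−6}(a_t) = P_3(cosh 2t)`. -/
theorem sph_neg_six_hyp (t : ℝ) :
    sph (-6) (hyp t) = (5 * Real.cosh (2 * t) ^ 3 - 3 * Real.cosh (2 * t)) / 2 := by
  rw [← sph_eight_hyp, ← sph_two_sub_of_ode 8 t]
  norm_num

end measure

end Summit.Ventures.HodgeRepro2.T5SU11SphericalLegendreHigher
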